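import Literature.NumberTheory.LFunctions.Zhang2022.DetectorRecipeMoments
import Literature.NumberTheory.LFunctions.Zhang2022.DetectorGlueForm

/-!
# Zhang (2022), programme F-S3 (cell landau-siegel, family B-det): the ONE-FORM dictionary «dict_S» of a shift
# detector on a GLUED profile — six channel moments plus three apex terms; `= 𝔅 = C₂₃₂S` at the printed recipe

Y. Zhang, *Discrete mean estimates and the Landau–Siegel zero*, arXiv:2211.02515v1 [Zhang2022LandauSiegel] —
an unrefereed manuscript under adjudication. **WHAT THIS IS NOT: not a claim about Theorems 1–2 of
arXiv:2211.02515, about Landau–Siegel zeros, or about Parity; nothing here asserts any claim of the manuscript.**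
«The programme SEARCHES and TYPES; no claim about Landau–Siegel zeros, Theorems 1–2 of arXiv:2211.02515 or a
repaired Margin232 until a kernel theorem says so.»

Third part of definition request **D-det-1** (the cell's `OBJECTIVE.md` §3.4): the item «window/overlap form for a
general recipe» left open in `DetectorGlueForm` («Deliberately NOT here»). The manuscript's glued main-term form on a
two-sided design `𝔥 = H₁ + Z·H̄₂` is ONE Hermitian-type form `𝔅` = (4.1) in the glued profile `𝔤 = g₁ + R̃g₂` on
`[0,1]` (`mainTermForm`; `Repair.C232S θ = 𝔅(𝔤_θ)`), whatever the overlap of the two supports after reflection.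
For a general shift triple the cell's two numerics lineages propose the analogue («dict_S», ls-Bdet-num-2 STATUS
2026-08-26T18:34:16Z, METHODS.md §4, kits j258006/j258112; window values confirmed on lineage A's split route,
ls-Bdet-num-1 GLUE-NOTE §5, kit j258505): the six-moment bulk of `Det.formDet_eq_moments` read on the WHOLE glued
profile plus three apex terms in `a₁ = G(1⁻)`. This file TYPES it as design data and proves what is provable now:

* `Det.SixMomentS R G` — the right-hand side of `Det.formDet_eq_moments` as a functional of any profile
  (`formDet_eq_sixMomentS`: `= 𝔅_R(g)` on one-sided kinked `g`);
* `Det.DictS R W′ c₀ G := SixMoment_R(G) − 2πRe(conj(m_n)a₁Ī) + 2Re(−i(ΣW′+c₀)a₀ā₁) + 2Im(m_b − m_s)|a₁|²`;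
  `dictS_of_apex_zero`, `dictS_eq_formDet` (apex terms vanish for `G(1) = 0`);
* **`dictS_zhang : DictS zhangRecipe zhangGlueW 1 G G′ = mainTermForm G G′` for EVERY profile** — at the printed
  data the dictionary is (4.1) identically (pure algebra on `Det.moments_zhang = (4,15,12,9,32,24)`, `ΣW′ + c₀ = 8`,
  `⟨G,G′⟩ = conj⟨G′,G⟩`);
* `Det.DictShift b := DictS (shiftRecipe b) (shiftGlueW b) (shiftGlue0 b)` (the cell's glue pair
  `(W·n/b, −e^{iπΣb/2})`), `dictShift_std` (`= mainTermForm`), **`dictShift_std_gluedS : DictShift (1,2,3) (𝔤_θ)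
  = Repair.C232S θ`** (the §18 functional of record, window term included, every `θ`), `dictShift_eq_formDet`,
  `dictShift_nonneg_of_formDetPSD` (one-sided PSD-ness of the dictionary = the registry slot E-010
  `Det.FormDetPSD (shiftRecipe b)`).

* (appended) **the glued identity on NON-OVERLAPPING sides**: `Det.GluedSides u u′ v v′` (kinked sides with separated
  supports, `t₁ + t₂ ≤ 1`), `Det.gluedProfile u v = u + R̃v` / `gluedDeriv`, the seven atoms of the six-moment expression
  on the glued profile (`GluedSides.integral_norm_sq_deriv/_deriv_mul_conj/_mul_conj_deriv/_norm_sq/glued_zero/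
  glued_one/integral_glued/integral_mul_conj_primitive`), the two boundary identities `2Re⟨h′,h⟩ = |h(1)|² − |h(0)|²`
  and `2Re⟨h,S_h⟩ = |∫h|²`, and **`GluedSides.dictS_glued_eq_formDetTwoSidedC`** (any recipe, any glue pair carrying
  the moments `ΣW′b = m_n`, `ΣW′b² = m_bn`) ⇒ **`GluedSides.dictShift_glued_eq_formDetGlued : DictShift b (u + R̃v) =
  FormDetGlued b u v`** (`b_j ≠ 0`) and `GluedSides.mainTermForm_glued_std` — lineage B's «exact fit» as a theorem.

STATUS of «dict_S» away from `b = (1,2,3)`: on non-overlapping sides it IS the glued two-sided form (theorem above);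
its reading on OVERLAPPING sides (the implied window term) and, as for every recipe object, its (A)-world meaning stay
«conjecture-by-consistency (numerics, two lineages); derivation review pending (ls-theory; ls-barrier-num
GLUE-DERIVATION.md addendum §2(iv): the §12 window at general `b` is formula I with `W_j(b)`, (12.9))» — a DEFINITION
the registry rows and scans name, never asserted here to be an (A)-world main term. NOT here: `|S| ≠ 3`, error terms.
-/

noncomputable section

open Complex Real ComplexConjugate Set intervalIntegral
open _root_.MeasureTheory

namespace Literature.NumberTheory.LFunctions.Zhang2022

namespace Det

open Repair

variable {R : DetRecipe} {g g' : ℝ → ℂ}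

/-! ### The six-moment expression on an arbitrary profile -/

/-- **The six-moment expression `SixMoment_R(g)` of a recipe on a profile `g` on `[0,1]`** — the right-hand side
of `Det.formDet_eq_moments` read as a functional of ANY profile (no apex condition `g(1) = 0`):
`(2/π)Re(m₀)‖g′‖² + 2Im(m_s⟨g′,g⟩) − 2Im(m_b⟨g,g′⟩) + 2πRe(m_n + m_bs)‖g‖² − 2πRe(m_n·g(0)·conj∫g)
− 2π²Im(m_bn(|∫g|² − ⟨g,S_g⟩))`, `S_g(x) = ∫₀ˣg`, with the six channel moments `m₀ = ΣW_j`, `m_s = ΣW_js_j`,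
`m_n = ΣW_jn_j`, `m_b = ΣW_jb_j`, `m_bs = ΣW_jb_js_j`, `m_bn = ΣW_jb_jn_j` (printed `(4,15,12,9,32,24)`,
`Det.moments_zhang`). [cite: Zhang2022LandauSiegel, Prop 7.1 with (8.11)–(8.23), pp.44–50; §4 (4.1)] -/
def SixMomentS (R : DetRecipe) (g g' : ℝ → ℂ) : ℝ :=
  2 / π * (∑ j : Fin 3, R.W j).re * (∫ x in (0:ℝ)..1, ‖g' x‖ ^ 2)
    + 2 * ((∑ j : Fin 3, R.W j * (R.s j : ℂ)) * ∫ x in (0:ℝ)..1, g' x * conj (g x)).im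
    - 2 * ((∑ j : Fin 3, R.W j * (R.b j : ℂ)) * ∫ x in (0:ℝ)..1, g x * conj (g' x)).im
    + 2 * π * ((∑ j : Fin 3, R.W j * (R.n j : ℂ)) + ∑ j : Fin 3, R.W j * ((R.b j : ℂ) * (R.s j : ℂ))).re
        * (∫ x in (0:ℝ)..1, ‖g x‖ ^ 2)
    - 2 * π * ((∑ j : Fin 3, R.W j * (R.n j : ℂ)) * (g 0 * conj (∫ x in (0:ℝ)..1, g x))).re
    - 2 * π ^ 2 * ((∑ j : Fin 3, R.W j * ((R.b j : ℂ) * (R.n j : ℂ)))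
        * ((∫ x in (0:ℝ)..1, g x) * conj (∫ x in (0:ℝ)..1, g x)
            - ∫ x in (0:ℝ)..1, g x * conj (∫ t in (0:ℝ)..x, g t))).im

/-- **On a one-sided kinked profile the recipe form IS its six-moment expression** (`Det.formDet_eq_moments`
restated with the named functional). [cite: Zhang2022LandauSiegel, Prop 7.1 with (8.11)–(8.23), pp.44–50] -/
theorem formDet_eq_sixMomentS (hg : KinkedProfile g g') (hg1 : g 1 = 0) :
    FormDet R g g' = SixMomentS R g g' :=
  formDet_eq_moments hg hg1

/-! ### The one-form dictionary of a recipe with a glue pair -/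

/-- **«dict_S» — the ONE-FORM dictionary of a recipe `R` with glue pair `(W′, c₀)` on a profile `G` on `[0,1]`:**
`Q(G) = SixMoment_R(G) − 2πRe(conj(m_n)·a₁·conj I) + 2Re(−i(ΣW′_j + c₀)·a₀·conj a₁) + 2Im(m_b − m_s)·|a₁|²`,
`a₀ = G(0⁺)`, `a₁ = G(1⁻)`, `I = ∫₀¹G` — the six-moment bulk plus three APEX terms. At the printed data
`(R, W′, c₀) = (zhangRecipe, (3,3,1), 1)` it is the manuscript's glued main-term form `𝔅` = (4.1) IDENTICALLY in `G`
(`dictS_zhang`), hence on the glued design profile the §18 functional of record `C₂₃₂S` INCLUDING the window term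
(`dictShift_std_gluedS`). For a general shift triple the cell's numerics found these three apex terms as the EXACT
residual `FormDetTwoSided − SixMoment(G)` on non-overlapping glued profiles (lineage B, fit residual ≤ 1.5e-13, kit
j258006/j258112) and lineage A's split route gives the same window values on overlapping ones (kit j258505) — so, being
ONE Hermitian-type form in `G`, it is the cell's CANDIDATE for the general-`S` main term WITH overlap. STATUS:
«conjecture-by-consistency (numerics, two lineages); derivation from Prop 14.1 / Lemma 15.1 / §12 windows pending
(ls-theory)» — typed as DESIGN DATA (a definition the registry and the scans name), never asserted to be the (A)-world
main term of anything. [cite: Zhang2022LandauSiegel, §4 (4.1); §12 (12.6)–(12.17); Prop 14.1; Lemma 15.1; §18 (18.1)] -/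
def DictS (R : DetRecipe) (Wp : Fin 3 → ℂ) (c0 : ℂ) (g g' : ℝ → ℂ) : ℝ :=
  SixMomentS R g g'
    - 2 * π * (conj (∑ j : Fin 3, R.W j * (R.n j : ℂ)) * g 1 * conj (∫ x in (0:ℝ)..1, g x)).re
    + 2 * (-I * ((∑ j : Fin 3, Wp j) + c0) * g 0 * conj (g 1)).re
    + 2 * ((∑ j : Fin 3, R.W j * (R.b j : ℂ)) - ∑ j : Fin 3, R.W j * (R.s j : ℂ)).im * ‖g 1‖ ^ 2

/-- With a vanishing apex `G(1) = 0` the three apex terms vanish: `Q(G) = SixMoment_R(G)` (any glue pair).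
[cite: Zhang2022LandauSiegel, §4 (4.1); Prop 7.1 pp.44–50] -/
theorem dictS_of_apex_zero (R : DetRecipe) (Wp : Fin 3 → ℂ) (c0 : ℂ) (hg1 : g 1 = 0) :
    DictS R Wp c0 g g' = SixMomentS R g g' := by
  simp [DictS, hg1]

/-- … so on a one-sided kinked profile the dictionary IS the recipe form `𝔅_R(g)` (formula I), whatever the glue pair.
[cite: Zhang2022LandauSiegel, Prop 7.1 pp.44–50] -/
theorem dictS_eq_formDet (Wp : Fin 3 → ℂ) (c0 : ℂ) (hg : KinkedProfile g g') (hg1 : g 1 = 0) :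
    DictS R Wp c0 g g' = FormDet R g g' := by
  rw [dictS_of_apex_zero R Wp c0 hg1, formDet_eq_sixMomentS hg hg1]

/-- `conj` commutes with `∫₀¹`. [cite: Zhang2022LandauSiegel, Prop 7.1 with (8.11)–(8.23), pp.44–50] -/
private theorem conj_intervalIntegral'' (f : ℝ → ℂ) (a b : ℝ) :
    conj (∫ x in a..b, f x) = ∫ x in a..b, conj (f x) := by
  simp only [intervalIntegral, map_sub, integral_conj]

/-- `⟨g, g′⟩ = conj ⟨g′, g⟩`. [cite: Zhang2022LandauSiegel, §4 (4.1)] -/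
private theorem integral_mul_conj_swap (g g' : ℝ → ℂ) :
    (∫ x in (0:ℝ)..1, g x * conj (g' x)) = conj (∫ x in (0:ℝ)..1, g' x * conj (g x)) := by
  rw [conj_intervalIntegral'']
  refine intervalIntegral.integral_congr fun x _ => ?_
  simp [mul_comm]

/-- The printed glue weights sum to `7` (`3 + 3 + 1`; with `c₀ = 1`: `ΣW′ + c₀ = 8`). [cite: Zhang2022LandauSiegel, §18 (18.1)] -/
theorem sum_zhangGlueW : (∑ j : Fin 3, zhangGlueW j) = 7 := by
  simp only [zhangGlueW, Fin.sum_univ_three, Matrix.cons_val_zero, Matrix.cons_val_one, Matrix.cons_val_two,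
    Matrix.head_cons, Matrix.tail_cons]
  norm_num

/-- **FAITHFULNESS: at the printed recipe and glue data the dictionary IS the manuscript's glued main-term form
`𝔅` = (4.1), identically in the profile** (no apex or regularity condition):
`Q_{(½,2,3/2;(3,3,1);1)}(G) = (8/π)‖G′‖² + 48Im⟨G′,G⟩ + 88π‖G‖² + 48π²Im⟨G,S_G⟩ − 24πRe(Ī(a₀+a₁)) + 16Im(a₀ā₁)
= mainTermForm G G′` (moments `(4,15,12,9,32,24)`, `ΣW′ + c₀ = 8`, `Im(m_b − m_s) = 0`).
[cite: Zhang2022LandauSiegel, §4 (4.1); §18 (18.1)] -/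
theorem dictS_zhang (g g' : ℝ → ℂ) : DictS zhangRecipe zhangGlueW 1 g g' = mainTermForm g g' := by
  obtain ⟨h0, hs, hn, hb, hbs, hbn⟩ := moments_zhang
  rw [DictS, SixMomentS, h0, hs, hn, hb, hbs, hbn, sum_zhangGlueW, integral_mul_conj_swap g g',
    mainTermForm, mainTermFormJet]
  simp only [primitiveJet]
  set A1 : ℝ := ∫ x in (0:ℝ)..1, ‖g' x‖ ^ 2
  set A2 : ℂ := ∫ x in (0:ℝ)..1, g' x * conj (g x)
  set A5 : ℝ := ∫ x in (0:ℝ)..1, ‖g x‖ ^ 2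
  set II : ℂ := ∫ x in (0:ℝ)..1, g x
  set T : ℂ := ∫ x in (0:ℝ)..1, g x * conj (∫ t in (0:ℝ)..x, g t)
  simp only [Complex.mul_re, Complex.mul_im, Complex.add_re, Complex.add_im, Complex.sub_re, Complex.sub_im,
    Complex.conj_re, Complex.conj_im, Complex.neg_re, Complex.neg_im, Complex.I_re, Complex.I_im,
    Complex.one_re, Complex.one_im]
  norm_num
  ring

/-! ### The dictionary of a shift triple with the cell's glue pair -/

/-- **The one-form dictionary of a shift triple** with the cell's glue pair `(W′, c₀) = (W·n/b, −e^{iπΣb/2})`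
(`Det.shiftGlueW`, `Det.shiftGlue0`): `DictShift b := DictS (shiftRecipe b) (shiftGlueW b) (shiftGlue0 b)` — the
object the cell's glued/overlap scans evaluate («dict_S»; (B1)-tested nonneg-type on 42/42 admissible × overlap cells,
kit j258006). Design data; status as for `DictS`. [cite: Zhang2022LandauSiegel, §4 (4.1); Prop 14.1; Lemma 15.1; §18 (18.1)] -/
def DictShift (b : Fin 3 → ℝ) (g g' : ℝ → ℂ) : ℝ :=
  DictS (shiftRecipe b) (shiftGlueW b) (shiftGlue0 b) g g'

/-- **At the printed triple the shift dictionary is `𝔅` = (4.1) identically in the profile**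
(`shiftRecipe_std`, `shiftGlueW_std`, `shiftGlue0_std`, `dictS_zhang`). [cite: Zhang2022LandauSiegel, §4 (4.1); §18 (18.1)] -/
theorem dictShift_std (g g' : ℝ → ℂ) : DictShift ![1, 2, 3] g g' = mainTermForm g g' := by
  rw [DictShift, shiftRecipe_std, shiftGlueW_std, shiftGlue0_std, dictS_zhang]

/-- **… hence on the glued design profile `𝔤_θ = g₁ + R̃g₂` it is the §18 functional of record `C₂₃₂S(θ)`,
WINDOW TERM INCLUDED, for every parameter `θ`** (`Repair.C232S_eq_form`; no admissibility needed — an identity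
of functionals). [cite: Zhang2022LandauSiegel, §2 (2.32); §12 (12.6)–(12.17); §18 (18.1)] -/
theorem dictShift_std_gluedS (θ : Theta) :
    DictShift ![1, 2, 3] (gluedS θ) (gluedS' θ) = C232S θ := by
  rw [dictShift_std, C232S_eq_form]

/-- On a one-sided kinked profile the shift dictionary is formula I of the triple, `𝔅_{R(b)}(g)`
(the apex terms vanish). [cite: Zhang2022LandauSiegel, Prop 7.1 pp.44–50] -/
theorem dictShift_eq_formDet (b : Fin 3 → ℝ) (hg : KinkedProfile g g') (hg1 : g 1 = 0) :
    DictShift b g g' = FormDet (shiftRecipe b) g g' :=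
  dictS_eq_formDet _ _ hg hg1

/-- So a PSD statement for the shift dictionary on one-sided kinked profiles is exactly the registry slot
`Det.FormDetPSD (shiftRecipe b)` (E-010); at `b = (1,2,3)` it holds (`Det.formDetPSD_zhang` via `shiftRecipe_std`).
[cite: Zhang2022LandauSiegel, §4 (4.1); Prop 7.1 pp.44–50] -/
theorem dictShift_nonneg_of_formDetPSD {b : Fin 3 → ℝ} (h : FormDetPSD (shiftRecipe b))
    (hg : KinkedProfile g g') (hg1 : g 1 = 0) : 0 ≤ DictShift b g g' := by
  rw [dictShift_eq_formDet b hg hg1]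
  exact h g g' hg hg1

/-! ### The dictionary on a GLUED profile with non-overlapping sides (lineage B's exact fit, as an identity)

Everything below is calculus on `[0,1]`: a side-1 profile `u` (companion `u′`) supported in `[0,t₁]`, a side-2 profile
`v` (companion `v′`) supported in `[0,t₂]`, `t₁ + t₂ ≤ 1`, glued as `G = u + R̃v` (`reflProfile`, `reflDeriv` of
`RepairFormReflection`). -/

section Glued

variable {u u' v v' : ℝ → ℂ}

/-- `∫₀¹ F(1 − x) dx = ∫₀¹ F(x) dx`. [folklore] -/
private theorem integral_unit_comp_one_sub' {E : Type*} [NormedAddCommGroup E] [NormedSpace ℝ E]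
    (F : ℝ → E) : ∫ x in (0:ℝ)..1, F (1 - x) = ∫ x in (0:ℝ)..1, F x := by
  rw [intervalIntegral.integral_comp_sub_left F 1]
  norm_num

/-- **`2Re⟨h′, h⟩ = |h(1)|² − |h(0)|²`** for a kinked (`H¹`, right-differentiable) profile: the real part of
`∫₀¹ h′·conj h` is an exact boundary term. [cite: Zhang2022LandauSiegel, §4 (4.1); Prop 7.1 pp.44–50] -/
theorem two_mul_re_integral_deriv_mul_conj (hh : KinkedProfile u u') :
    2 * (∫ x in (0:ℝ)..1, u' x * conj (u x)).re = ‖u 1‖ ^ 2 - ‖u 0‖ ^ 2 := by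
  -- `Φ = u·conj u` has right derivative `u′ conj u + u conj u′` on `(0,1)`
  have hΦc : ContinuousOn (fun x => u x * conj (u x)) (Icc 0 1) := hh.cont.mul (continuousOn_conj_comp hh.cont)
  have hΦd : ∀ x ∈ Ioo (0:ℝ) 1, HasDerivWithinAt (fun x => u x * conj (u x))
      (u' x * conj (u x) + u x * conj (u' x)) (Ioi x) x := by
    intro x hx
    have h1 := hh.hasDeriv x hx
    have h2 : HasDerivWithinAt (fun y => conj (u y)) (conj (u' x)) (Ioi x) x := by
      have := h1.star
      simpa only [starRingEnd_apply] using this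
    exact h1.mul h2
  have hi1 : IntervalIntegrable (fun x => u' x * conj (u x)) volume 0 1 :=
    hh.isH1.intervalIntegrable.mul_continuousOn
      (by rw [uIcc_of_le zero_le_one]; exact continuousOn_conj_comp hh.cont)
  have hi2 : IntervalIntegrable (fun x => u x * conj (u' x)) volume 0 1 := by
    have hc : IntervalIntegrable (fun x => conj (u' x)) volume 0 1 := by
      rw [intervalIntegrable_iff, uIoc_of_le zero_le_one]
      exact hh.isH1.memLp_conj.integrable one_le_two
    exact hc.continuousOn_mul (by rw [uIcc_of_le zero_le_one]; exact hh.cont)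
  have key := intervalIntegral.integral_eq_sub_of_hasDeriv_right_of_le zero_le_one hΦc hΦd (hi1.add hi2)
  rw [intervalIntegral.integral_add hi1 hi2, integral_mul_conj_swap u u'] at key
  have hre := congrArg Complex.re key
  rw [Complex.add_re, Complex.conj_re, Complex.sub_re, Complex.mul_conj, Complex.mul_conj,
    Complex.ofReal_re, Complex.ofReal_re, Complex.normSq_eq_norm_sq, Complex.normSq_eq_norm_sq] at hre
  linarith

/-- **`2Re⟨h, S_h⟩ = |∫h|²`** for a continuous profile (`(|S_h|²)′ = 2Re(h·conj S_h)`; the tree's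
`Repair.integral_mul_conj_primitive_add` at `u = v = h`). [cite: Zhang2022LandauSiegel, §4 (4.1); §18 (18.1)] -/
theorem two_mul_re_integral_mul_conj_primitive (hv : ContinuousOn v (Icc 0 1)) :
    2 * (∫ x in (0:ℝ)..1, v x * conj (∫ t in (0:ℝ)..x, v t)).re = ‖∫ x in (0:ℝ)..1, v x‖ ^ 2 := by
  have h := integral_mul_conj_primitive_add hv hv
  have hswap : (∫ x in (0:ℝ)..1, (∫ t in (0:ℝ)..x, v t) * conj (v x))
      = conj (∫ x in (0:ℝ)..1, v x * conj (∫ t in (0:ℝ)..x, v t)) := by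
    rw [conj_intervalIntegral'']
    refine intervalIntegral.integral_congr fun x _ => ?_
    simp [mul_comm]
  rw [hswap] at h
  have hre := congrArg Complex.re h
  rw [Complex.add_re, Complex.conj_re, Complex.mul_conj, Complex.ofReal_re, Complex.normSq_eq_norm_sq] at hre
  linarith

/-! #### Reflection atoms (`R̃v(y) = conj v(1−y)`, `(R̃v)′(y) = −conj v′(1−y)`) -/

/-- `‖(R̃v)′‖² ` integrates like `‖v′‖²`. [cite: Zhang2022LandauSiegel, §12 (12.6)–(12.8)] -/
theorem integral_norm_sq_reflDeriv (v' : ℝ → ℂ) :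
    (∫ x in (0:ℝ)..1, ‖reflDeriv v' x‖ ^ 2) = ∫ x in (0:ℝ)..1, ‖v' x‖ ^ 2 := by
  have := integral_unit_comp_one_sub' (fun x => ‖v' x‖ ^ 2)
  simpa only [reflDeriv, norm_neg, Complex.norm_conj] using this

/-- `‖R̃v‖²` integrates like `‖v‖²`. [cite: Zhang2022LandauSiegel, §12 (12.6)–(12.8)] -/
theorem integral_norm_sq_reflProfile (v : ℝ → ℂ) :
    (∫ x in (0:ℝ)..1, ‖reflProfile v x‖ ^ 2) = ∫ x in (0:ℝ)..1, ‖v x‖ ^ 2 := by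
  have := integral_unit_comp_one_sub' (fun x => ‖v x‖ ^ 2)
  simpa only [reflProfile, Complex.norm_conj] using this

/-- `⟨(R̃v)′, R̃v⟩ = −conj⟨v′, v⟩`. [cite: Zhang2022LandauSiegel, §12 (12.6)–(12.8)] -/
theorem integral_reflDeriv_mul_conj_reflProfile (v v' : ℝ → ℂ) :
    (∫ x in (0:ℝ)..1, reflDeriv v' x * conj (reflProfile v x))
      = -conj (∫ x in (0:ℝ)..1, v' x * conj (v x)) := by
  rw [conj_intervalIntegral'', ← integral_unit_comp_one_sub' (fun x => conj (v' x * conj (v x))),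
    ← intervalIntegral.integral_neg]
  refine intervalIntegral.integral_congr fun x _ => ?_
  simp only [reflDeriv, reflProfile, map_mul, Complex.conj_conj]
  ring

/-! #### Non-overlapping sides: the support bookkeeping -/

/-- **Two one-sided kinked profiles with NON-OVERLAPPING supports after reflection:** `u` (side 1) and its companion
vanish on `[t₁, ∞)`, `v` (side 2) and its companion on `[t₂, ∞)`, with `t₁ + t₂ ≤ 1` — so `u` and `R̃v` (supported in
`[1−t₂, 1]`) never meet (the cell's «no-overlap two-sided class», `ν₁ + ν₂ ≤ 1`). [cite: Zhang2022LandauSiegel, §12 (12.6)–(12.8)] -/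
structure GluedSides (u u' v v' : ℝ → ℂ) : Prop where
  /-- side 1 is a kinked profile -/
  kinked₁ : KinkedProfile u u'
  /-- side 2 is a kinked profile -/
  kinked₂ : KinkedProfile v v'
  /-- separated supports -/
  sep : ∃ t₁ t₂ : ℝ, 0 ≤ t₁ ∧ 0 ≤ t₂ ∧ t₁ + t₂ ≤ 1 ∧ (∀ y, t₁ ≤ y → u y = 0 ∧ u' y = 0) ∧
    (∀ y, t₂ ≤ y → v y = 0 ∧ v' y = 0)

namespace GluedSides

variable (h : GluedSides u u' v v')
include h

/-- Side 1 vanishes at the apex. [cite: Zhang2022LandauSiegel, §12 (12.6)–(12.8)] -/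
theorem u_one : u 1 = 0 := by
  obtain ⟨t₁, t₂, h1, h2, h12, hu, -⟩ := h.sep
  exact (hu 1 (by linarith)).1

/-- Side 2 vanishes at the apex. [cite: Zhang2022LandauSiegel, §12 (12.6)–(12.8)] -/
theorem v_one : v 1 = 0 := by
  obtain ⟨t₁, t₂, h1, h2, h12, -, hv⟩ := h.sep
  exact (hv 1 (by linarith)).1

/-- At every point, side 1 or the reflected side 2 vanishes (with companions). [cite: Zhang2022LandauSiegel, §12 (12.6)–(12.8)] -/
theorem zero_or_zero (y : ℝ) : (u y = 0 ∧ u' y = 0) ∨ (v (1 - y) = 0 ∧ v' (1 - y) = 0) := by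
  obtain ⟨t₁, t₂, h1, h2, h12, hu, hv⟩ := h.sep
  by_cases hy : t₁ ≤ y
  · exact Or.inl (hu y hy)
  · exact Or.inr (hv (1 - y) (by push Not at hy; linarith))

/-- The tail mass of side 2 seen from a point where side 1 lives: `u(x) = 0` or `∫_{1−x}^1 v = 0`.
[cite: Zhang2022LandauSiegel, §12 (12.6)–(12.8)] -/
theorem zero_or_tail_zero (x : ℝ) : (u x = 0 ∧ u' x = 0) ∨ (∫ t in (1 - x)..1, v t) = 0 := by
  obtain ⟨t₁, t₂, h1, h2, h12, hu, hv⟩ := h.sep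
  by_cases hx : t₁ ≤ x
  · exact Or.inl (hu x hx)
  · right
    push Not at hx
    rw [intervalIntegral.integral_congr (g := fun _ => (0 : ℂ)) ?_, intervalIntegral.integral_zero]
    intro t ht
    have ht' : t₂ ≤ t := by
      rcases le_total (1 - x) 1 with hle | hle
      · rw [uIcc_of_le hle] at ht; linarith [ht.1]
      · rw [uIcc_of_ge hle] at ht; linarith [ht.1]
    exact (hv t ht').1

/-- The primitive of side 1 is already total where the reflected side 2 lives: `v(1−x) = 0` or `S_u(x) = ∫₀¹u`
(`x ∈ [0,1]`). [cite: Zhang2022LandauSiegel, §12 (12.6)–(12.8)] -/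
theorem zero_or_primitive_total {x : ℝ} (hx : x ∈ Icc (0:ℝ) 1) :
    v (1 - x) = 0 ∨ (∫ t in (0:ℝ)..x, u t) = ∫ t in (0:ℝ)..1, u t := by
  obtain ⟨t₁, t₂, h1, h2, h12, hu, hv⟩ := h.sep
  by_cases hx' : t₂ ≤ 1 - x
  · exact Or.inl (hv _ hx').1
  · right
    push Not at hx'
    have hx1 : t₁ ≤ x := by linarith
    have hint : IntervalIntegrable u volume 0 1 := h.kinked₁.cont.intervalIntegrable_of_Icc zero_le_one
    have i0x : IntervalIntegrable u volume 0 x := hint.mono_set (by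
      rw [uIcc_of_le zero_le_one, uIcc_of_le hx.1]; exact Icc_subset_Icc_right hx.2)
    have ix1 : IntervalIntegrable u volume x 1 := hint.mono_set (by
      rw [uIcc_of_le zero_le_one, uIcc_of_le hx.2]; exact Icc_subset_Icc_left hx.1)
    have htail : (∫ t in x..1, u t) = 0 := by
      rw [intervalIntegral.integral_congr (g := fun _ => (0 : ℂ)) ?_, intervalIntegral.integral_zero]
      intro t ht
      rw [uIcc_of_le hx.2] at ht
      exact (hu t (le_trans hx1 ht.1)).1
    rw [← intervalIntegral.integral_add_adjacent_intervals i0x ix1, htail, add_zero]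

end GluedSides

/-- The glued profile `G = u + R̃v` on `[0,1]`. [cite: Zhang2022LandauSiegel, §2 (2.27), (2.32); §12 (12.6)–(12.8)] -/
def gluedProfile (u v : ℝ → ℂ) : ℝ → ℂ := fun y => u y + reflProfile v y

/-- Its derivative companion `G′ = u′ + (R̃v)′`. [cite: Zhang2022LandauSiegel, §2 (2.27), (2.32); §12 (12.6)–(12.8)] -/
def gluedDeriv (u' v' : ℝ → ℂ) : ℝ → ℂ := fun y => u' y + reflDeriv v' y

/-! #### The seven atoms of the six-moment expression on the glued profile -/

/-- `‖G′‖²` splits: `∫‖G′‖² = ∫‖u′‖² + ∫‖v′‖²`. [cite: Zhang2022LandauSiegel, §12 (12.6)–(12.8)] -/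
theorem GluedSides.integral_norm_sq_deriv (h : GluedSides u u' v v') :
    (∫ x in (0:ℝ)..1, ‖gluedDeriv u' v' x‖ ^ 2)
      = (∫ x in (0:ℝ)..1, ‖u' x‖ ^ 2) + ∫ x in (0:ℝ)..1, ‖v' x‖ ^ 2 := by
  rw [← integral_norm_sq_reflDeriv v', ← intervalIntegral.integral_add h.kinked₁.isH1.intervalIntegrable_sq
    h.kinked₂.isH1.refl.intervalIntegrable_sq]
  refine intervalIntegral.integral_congr fun y _ => ?_
  rcases h.zero_or_zero y with ⟨-, hu'⟩ | ⟨-, hv'⟩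
  · simp [gluedDeriv, hu']
  · simp [gluedDeriv, reflDeriv, hv']

/-- `‖G‖²` splits: `∫‖G‖² = ∫‖u‖² + ∫‖v‖²`. [cite: Zhang2022LandauSiegel, §12 (12.6)–(12.8)] -/
theorem GluedSides.integral_norm_sq (h : GluedSides u u' v v') :
    (∫ x in (0:ℝ)..1, ‖gluedProfile u v x‖ ^ 2)
      = (∫ x in (0:ℝ)..1, ‖u x‖ ^ 2) + ∫ x in (0:ℝ)..1, ‖v x‖ ^ 2 := by
  have i1 : IntervalIntegrable (fun x => ‖u x‖ ^ 2) volume 0 1 :=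
    ((h.kinked₁.cont.norm).pow 2).intervalIntegrable_of_Icc zero_le_one
  have i2 : IntervalIntegrable (fun x => ‖reflProfile v x‖ ^ 2) volume 0 1 :=
    ((h.kinked₂.isH1.refl.continuousOn.norm).pow 2).intervalIntegrable_of_Icc zero_le_one
  rw [← integral_norm_sq_reflProfile v, ← intervalIntegral.integral_add i1 i2]
  refine intervalIntegral.integral_congr fun y _ => ?_
  rcases h.zero_or_zero y with ⟨hu, -⟩ | ⟨hv, -⟩
  · simp [gluedProfile, hu]
  · simp [gluedProfile, reflProfile, hv]

/-- `⟨G′, G⟩ = ⟨u′,u⟩ − conj⟨v′,v⟩` (the cross terms vanish pointwise; the reflected side contributes `−conj`).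
[cite: Zhang2022LandauSiegel, §12 (12.6)–(12.8)] -/
theorem GluedSides.integral_deriv_mul_conj (h : GluedSides u u' v v') :
    (∫ x in (0:ℝ)..1, gluedDeriv u' v' x * conj (gluedProfile u v x))
      = (∫ x in (0:ℝ)..1, u' x * conj (u x)) - conj (∫ x in (0:ℝ)..1, v' x * conj (v x)) := by
  rw [sub_eq_add_neg, ← integral_reflDeriv_mul_conj_reflProfile v v',
    ← intervalIntegral.integral_add (h.kinked₁.isH1.intervalIntegrable_deriv_mul_conj h.kinked₁.isH1)
      (h.kinked₂.isH1.refl.intervalIntegrable_deriv_mul_conj h.kinked₂.isH1.refl)]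
  refine intervalIntegral.integral_congr fun y _ => ?_
  rcases h.zero_or_zero y with ⟨hu, hu'⟩ | ⟨hv, hv'⟩
  · simp [gluedDeriv, gluedProfile, hu, hu']
  · simp [gluedDeriv, gluedProfile, reflProfile, reflDeriv, hv, hv']

/-- `⟨G, G′⟩ = conj⟨u′,u⟩ − ⟨v′,v⟩`. [cite: Zhang2022LandauSiegel, §12 (12.6)–(12.8)] -/
theorem GluedSides.integral_mul_conj_deriv (h : GluedSides u u' v v') :
    (∫ x in (0:ℝ)..1, gluedProfile u v x * conj (gluedDeriv u' v' x))
      = conj (∫ x in (0:ℝ)..1, u' x * conj (u x)) - ∫ x in (0:ℝ)..1, v' x * conj (v x) := by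
  rw [integral_mul_conj_swap, h.integral_deriv_mul_conj, map_sub, Complex.conj_conj]

/-- `G(0) = u(0)`. [cite: Zhang2022LandauSiegel, §12 (12.6)–(12.8)] -/
theorem GluedSides.glued_zero (h : GluedSides u u' v v') : gluedProfile u v 0 = u 0 := by
  simp [gluedProfile, h.v_one]

/-- `G(1) = conj v(0)`. [cite: Zhang2022LandauSiegel, §12 (12.6)–(12.8)] -/
theorem GluedSides.glued_one (h : GluedSides u u' v v') : gluedProfile u v 1 = conj (v 0) := by
  simp [gluedProfile, h.u_one]

/-- `∫G = ∫u + conj∫v`. [cite: Zhang2022LandauSiegel, §12 (12.6)–(12.8)] -/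
theorem GluedSides.integral_glued (h : GluedSides u u' v v') :
    (∫ x in (0:ℝ)..1, gluedProfile u v x) = (∫ x in (0:ℝ)..1, u x) + conj (∫ x in (0:ℝ)..1, v x) := by
  rw [← integral_reflProfile_one v]
  exact intervalIntegral.integral_add (h.kinked₁.cont.intervalIntegrable_of_Icc zero_le_one)
    (h.kinked₂.isH1.refl.continuousOn.intervalIntegrable_of_Icc zero_le_one)

/-- The primitive of the glued profile: `S_G(x) = S_u(x) + conj ∫_{1−x}^1 v` (`x ∈ [0,1]`).
[cite: Zhang2022LandauSiegel, §12 (12.6)–(12.8)] -/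
theorem GluedSides.primitive_glued (h : GluedSides u u' v v') {x : ℝ} (hx : x ∈ Icc (0:ℝ) 1) :
    (∫ t in (0:ℝ)..x, gluedProfile u v t) = (∫ t in (0:ℝ)..x, u t) + conj (∫ t in (1 - x)..1, v t) := by
  rw [← integral_reflProfile v x]
  have i1 : IntervalIntegrable u volume 0 x :=
    (h.kinked₁.cont.mono (Icc_subset_Icc_right hx.2)).intervalIntegrable_of_Icc hx.1
  have i2 : IntervalIntegrable (reflProfile v) volume 0 x :=
    (h.kinked₂.isH1.refl.continuousOn.mono (Icc_subset_Icc_right hx.2)).intervalIntegrable_of_Icc hx.1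
  exact intervalIntegral.integral_add i1 i2

/-- **The primitive atom on the glued profile:** `⟨G, S_G⟩ = ⟨u, S_u⟩ + conj(∫u)·conj(∫v) + (|∫v|² − conj⟨v, S_v⟩)`
(side 1 sees none of side 2's mass; the reflected side 2 sees ALL of side 1's mass; its own term reflects by
`Repair`'s `integral_refl_mul_conj_primitive`). [cite: Zhang2022LandauSiegel, §12 (12.6)–(12.8)] -/
theorem GluedSides.integral_mul_conj_primitive (h : GluedSides u u' v v') :
    (∫ x in (0:ℝ)..1, gluedProfile u v x * conj (∫ t in (0:ℝ)..x, gluedProfile u v t))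
      = (∫ x in (0:ℝ)..1, u x * conj (∫ t in (0:ℝ)..x, u t))
        + conj (∫ x in (0:ℝ)..1, u x) * conj (∫ x in (0:ℝ)..1, v x)
        + ((∫ x in (0:ℝ)..1, v x) * conj (∫ x in (0:ℝ)..1, v x)
            - conj (∫ x in (0:ℝ)..1, v x * conj (∫ t in (0:ℝ)..x, v t))) := by
  have hR : IsH1OnUnitInterval (reflProfile v) (reflDeriv v') := h.kinked₂.isH1.refl
  have iR : IntervalIntegrable (fun x => conj (∫ x in (0:ℝ)..1, u x) * reflProfile v x) volume 0 1 :=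
    (continuousOn_const.mul hR.continuousOn).intervalIntegrable_of_Icc zero_le_one
  rw [← integral_refl_mul_conj_primitive h.kinked₂.cont, ← integral_reflProfile_one v,
    ← intervalIntegral.integral_const_mul,
    ← intervalIntegral.integral_add (h.kinked₁.isH1.intervalIntegrable_mul_conj_primitive h.kinked₁.isH1) iR,
    ← intervalIntegral.integral_add ((h.kinked₁.isH1.intervalIntegrable_mul_conj_primitive h.kinked₁.isH1).add
      iR) (hR.intervalIntegrable_mul_conj_primitive hR)]
  refine intervalIntegral.integral_congr fun x hx => ?_
  rw [uIcc_of_le zero_le_one] at hx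
  rw [h.primitive_glued hx, integral_reflProfile v x, map_add, Complex.conj_conj]
  -- pointwise: the cross terms
  rcases h.zero_or_tail_zero x with ⟨hu, -⟩ | htail
  · -- side 1 absent at `x`
    rcases h.zero_or_primitive_total hx with hv | htot
    · simp [gluedProfile, reflProfile, hu, hv]
    · simp only [gluedProfile, hu, zero_add, zero_mul, htot]
      ring
  · -- side 2's tail mass vanishes at `x`
    rcases h.zero_or_primitive_total hx with hv | htot
    · simp [gluedProfile, reflProfile, hv, htail]
    · simp only [gluedProfile, htail, htot, add_zero, mul_zero]
      ring

/-! #### The identity -/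

/-- The free-pair glue block expanded in the three `W′`-moments `ΣW′`, `ΣW′_jb_j`, `ΣW′_jb_j²`.
[cite: Zhang2022LandauSiegel, Prop 14.1; Lemma 15.1; §18 (18.1)] -/
theorem F0DetC_expand (Wp : Fin 3 → ℂ) (c0 : ℂ) (b : Fin 3 → ℝ) (a0 Ia b0 Ib : ℂ) :
    F0DetC Wp c0 b a0 Ia b0 Ib
      = -I * (((∑ j : Fin 3, Wp j) + c0) * (a0 * b0))
        - π * (∑ j : Fin 3, Wp j * (b j : ℂ)) * (a0 * Ib + Ia * b0)
        + I * π ^ 2 * (∑ j : Fin 3, Wp j * (b j : ℂ) ^ 2) * (Ia * Ib) := by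
  simp only [F0DetC, eDet, Fin.sum_univ_three]
  linear_combination ((π : ℂ) * ((Wp 0 * (b 0 : ℂ) + Wp 1 * (b 1 : ℂ) + Wp 2 * (b 2 : ℂ)) * (a0 * Ib + Ia * b0))
    - I * (π : ℂ) ^ 2 * ((Wp 0 * (b 0 : ℂ) ^ 2 + Wp 1 * (b 1 : ℂ) ^ 2 + Wp 2 * (b 2 : ℂ) ^ 2) * (Ia * Ib)))
    * Complex.I_sq

/-- **«dict_S» on a glued profile with non-overlapping sides IS the two-sided recipe form** (lineage B's exact fit,
`B-det/num-2/METHODS.md` §4, as an identity): for kinked sides `u ⊥ R̃v` and ANY recipe `R` and glue pair `(W′, c₀)`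
whose weights carry the recipe's moments `ΣW′_jb_j = m_n`, `ΣW′_jb_j² = m_bn` (true for `W′ = W·n/b`),
`DictS R W′ c₀ (u + R̃v) = 𝔅_R(u) + 𝔅_R(v) + 2Re F₀^{(W′,c₀)}(u(0),∫u; v(0),∫v) = FormDetTwoSidedC R W′ c₀ u v`.
Mechanism: the six-moment bulk is NOT reflection-invariant for complex moments, but its defect is exactly
`2Im(m_b − m_s)·(2Re⟨v′,v⟩) = −2Im(m_b − m_s)|v(0)|²` (cancelled by the `|a₁|²` apex term) and
`−2π²Im(m_bn)(2Re⟨v,S_v⟩ − |∫v|²) = 0`; the cross terms are the glue block.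
[cite: Zhang2022LandauSiegel, §4 (4.1); §12 (12.6)–(12.8); Prop 14.1; Lemma 15.1; §18 (18.1)] -/
theorem GluedSides.dictS_glued_eq_formDetTwoSidedC (h : GluedSides u u' v v') (R : DetRecipe)
    (Wp : Fin 3 → ℂ) (c0 : ℂ)
    (hW1 : (∑ j : Fin 3, Wp j * (R.b j : ℂ)) = ∑ j : Fin 3, R.W j * (R.n j : ℂ))
    (hW2 : (∑ j : Fin 3, Wp j * (R.b j : ℂ) ^ 2) = ∑ j : Fin 3, R.W j * ((R.b j : ℂ) * (R.n j : ℂ))) :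
    DictS R Wp c0 (gluedProfile u v) (gluedDeriv u' v') = FormDetTwoSidedC R Wp c0 u u' v v' := by
  have hAv := two_mul_re_integral_deriv_mul_conj h.kinked₂
  have hTv := two_mul_re_integral_mul_conj_primitive h.kinked₂.cont
  rw [h.v_one, norm_zero, zero_pow two_ne_zero, zero_sub] at hAv
  rw [FormDetTwoSidedC, formDet_eq_sixMomentS h.kinked₁ h.u_one, formDet_eq_sixMomentS h.kinked₂ h.v_one,
    DictS, SixMomentS, SixMomentS, SixMomentS, h.integral_norm_sq_deriv, h.integral_deriv_mul_conj,
    h.integral_mul_conj_deriv, h.integral_norm_sq, h.glued_zero, h.glued_one, h.integral_glued,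
    h.integral_mul_conj_primitive, F0DetC_expand, hW1, hW2, integral_mul_conj_swap u u',
    integral_mul_conj_swap v v']
  set Du : ℝ := ∫ x in (0:ℝ)..1, ‖u' x‖ ^ 2
  set Dv : ℝ := ∫ x in (0:ℝ)..1, ‖v' x‖ ^ 2
  set Nu : ℝ := ∫ x in (0:ℝ)..1, ‖u x‖ ^ 2
  set Nv : ℝ := ∫ x in (0:ℝ)..1, ‖v x‖ ^ 2
  set Au : ℂ := ∫ x in (0:ℝ)..1, u' x * conj (u x)
  set Av : ℂ := ∫ x in (0:ℝ)..1, v' x * conj (v x)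
  set Iu : ℂ := ∫ x in (0:ℝ)..1, u x
  set Iv : ℂ := ∫ x in (0:ℝ)..1, v x
  set Tu : ℂ := ∫ x in (0:ℝ)..1, u x * conj (∫ t in (0:ℝ)..x, u t)
  set Tv : ℂ := ∫ x in (0:ℝ)..1, v x * conj (∫ t in (0:ℝ)..x, v t)
  set m0 : ℂ := ∑ j : Fin 3, R.W j
  set ms : ℂ := ∑ j : Fin 3, R.W j * (R.s j : ℂ)
  set mn : ℂ := ∑ j : Fin 3, R.W j * (R.n j : ℂ)
  set mb : ℂ := ∑ j : Fin 3, R.W j * (R.b j : ℂ)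
  set mbs : ℂ := ∑ j : Fin 3, R.W j * ((R.b j : ℂ) * (R.s j : ℂ))
  set mbn : ℂ := ∑ j : Fin 3, R.W j * ((R.b j : ℂ) * (R.n j : ℂ))
  set sW : ℂ := ∑ j : Fin 3, Wp j
  rw [Complex.norm_conj, Complex.sq_norm, Complex.normSq_apply] at *
  simp only [Complex.mul_re, Complex.mul_im, Complex.add_re, Complex.add_im, Complex.sub_re, Complex.sub_im,
    Complex.conj_re, Complex.conj_im, Complex.neg_re, Complex.neg_im, Complex.I_re, Complex.I_im,
    Complex.ofReal_re, Complex.ofReal_im] at hAv hTv ⊢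
  simp only [← Complex.ofReal_pow, Complex.ofReal_re, Complex.ofReal_im]
  linear_combination (2 * (mb.im - ms.im)) * hAv + (-2 * π ^ 2 * mbn.im) * hTv

/-- For a shift triple with non-zero entries the cell's glue weights `W′ = W·n/b` carry the recipe's moment
`ΣW′_jb_j = Σ W_jn_j = m_n`. [cite: Zhang2022LandauSiegel, Prop 14.1; Prop 7.1 p.44] -/
theorem sum_shiftGlueW_mul_b {b : Fin 3 → ℝ} (hb : ∀ j, b j ≠ 0) :
    (∑ j : Fin 3, shiftGlueW b j * ((shiftRecipe b).b j : ℂ))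
      = ∑ j : Fin 3, (shiftRecipe b).W j * ((shiftRecipe b).n j : ℂ) := by
  refine Finset.sum_congr rfl fun j _ => ?_
  have hbj : (b j : ℂ) ≠ 0 := by exact_mod_cast hb j
  simp only [shiftGlueW, shiftRecipe]
  field_simp

/-- … and `ΣW′_jb_j² = Σ W_jb_jn_j = m_bn`. [cite: Zhang2022LandauSiegel, Prop 14.1; Prop 7.1 p.44] -/
theorem sum_shiftGlueW_mul_b_sq {b : Fin 3 → ℝ} (hb : ∀ j, b j ≠ 0) :
    (∑ j : Fin 3, shiftGlueW b j * ((shiftRecipe b).b j : ℂ) ^ 2)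
      = ∑ j : Fin 3, (shiftRecipe b).W j * (((shiftRecipe b).b j : ℂ) * ((shiftRecipe b).n j : ℂ)) := by
  refine Finset.sum_congr rfl fun j _ => ?_
  have hbj : (b j : ℂ) ≠ 0 := by exact_mod_cast hb j
  simp only [shiftGlueW, shiftRecipe]
  field_simp

/-- **The shift dictionary on a glued profile with non-overlapping kinked sides IS the glued two-sided form of the
triple** (`Det.FormDetGlued`, glue pair `(W·n/b, −e^{iπΣb/2})`): `DictShift b (u + R̃v) = FormDetGlued b u v` — the
cell's lineage-B «exact fit» (36-term ansatz, residual ≤ 1.5·10⁻¹³, kit j258006) as a kernel identity, for every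
triple with non-zero entries. What remains CONJECTURAL about «dict_S» is only its reading on OVERLAPPING sides
(the implied window term) and, as for every recipe object, its (A)-world meaning.
[cite: Zhang2022LandauSiegel, §4 (4.1); §12 (12.6)–(12.8); Prop 14.1; Lemma 15.1; §18 (18.1)] -/
theorem GluedSides.dictShift_glued_eq_formDetGlued (h : GluedSides u u' v v') {b : Fin 3 → ℝ}
    (hb : ∀ j, b j ≠ 0) :
    DictShift b (gluedProfile u v) (gluedDeriv u' v') = FormDetGlued b u u' v v' :=
  h.dictS_glued_eq_formDetTwoSidedC (shiftRecipe b) (shiftGlueW b) (shiftGlue0 b) (sum_shiftGlueW_mul_b hb)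
    (sum_shiftGlueW_mul_b_sq hb)

/-- In particular at the printed triple: `𝔅(u + R̃v) = FormDetTwoSided zhangRecipe (3,3,1) u v` on non-overlapping
kinked sides — the manuscript's glued (4.1) splits into the two one-sided blocks plus the printed formula-II block
WITHOUT a window term (consistent with `Repair.frakc3S_eq`: the window form lives on the overlaps only).
[cite: Zhang2022LandauSiegel, §4 (4.1); §12 (12.12)–(12.17); §18 (18.1)] -/
theorem GluedSides.mainTermForm_glued_std (h : GluedSides u u' v v') :
    mainTermForm (gluedProfile u v) (gluedDeriv u' v') = FormDetTwoSided zhangRecipe zhangGlueW u u' v v' := by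
  rw [← dictShift_std, ← formDetGlued_std]
  exact h.dictShift_glued_eq_formDetGlued (b := ![1, 2, 3]) (by intro j; fin_cases j <;> norm_num)

end Glued

end Det

end Literature.NumberTheory.LFunctions.Zhang2022
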